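import Summits.QuantumFields.YangMills.Theorems.BalabanUVNodesPortZDPencilFTC

/-!
# NODE O port, row PT-A′ helper lane (PTZ-1, gen 3): THE SECOND CUMULANT — the interpolating first-order term `t ↦ T(F·I(A + tF))(V) ∕ T(I(A + tF))(V)` (the tilted fibre mean of the
# bracket) has derivative THE FIBRE VARIANCE `∫F² dμ − (∫F dμ)²` at `t = 0`, and the history pencil `t ↦ R_k(A + t·E)(W)` has derivative `m_W(t) − m_1(t) − E(bg_1)` AT EVERY `t`
# (tilted means) whose own slope at `0` is `Var_W − Var_1`: the pencil's Taylor coefficients at the zero-input end are the fibre cumulants of print's curly bracket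

[Balaban1987RG1] = [I] (CMP 109, 1987): (1.6) p. 261, (2.12)–(2.14) p. 268; [Balaban1988RG2Cluster] = [II] (CMP 116, 1988): (1.9) p. 4, p. 21 (second-order remainder of the history terms).

Seat `ymgap-nodeO-port-PTZ-1` g3 (prover, HELPER MODE; `--supports stmt-QuantumFields-27930 --as helper`).  Generic layer (0 tokens of the χ-cone of record); CRIT-1 Q-5 (β).  Companion of
`…PortZDPencilDerivative` (✓p808703), `…PortZDPencilFTC` (✓p810285), `…PortZDStepLaw` (✓p807160: the variance booking `|log-moment − mean| ≤ Var`).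
WHAT IS PROVED (0 sorry; no `def` ∕ `instance` ∕ `notation`):
* §1 generic (probability space, `|F| ≤ M` a.e.): ★ `hasDerivAt_integral_mul_exp_mul_of_ae_bound` (`t ↦ ∫ F e^{tF}` has derivative `∫ F² e^{tF}` at every `t`),
  ★ `hasDerivAt_tiltedMean_zero_of_ae_bound` (the tilted mean has derivative `∫F² − (∫F)²` at `0` — THE SECOND CUMULANT).
* §2 ★ `hasDerivAt_firstOrder_zero_of_stepLaw` — under the fibre law of the `A`-step: the interpolating first-order term has derivative `Var_μ(F)` at `t = 0`.
* §3 ★★ `stepOutT_pencil_eq` — the global pencil identity `R_k(A + tE)(W) = R_k(A)(W) + log-moment_W(tF_W) − log-moment_1(tF_1) − t·E(bg_1)` (every `t`; exported from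
  `…PencilDerivative`'s proof); ★★ `hasDerivAt_stepOutT_pencil` — AT EVERY `t`: `d∕dt R_k(A + tE)(W) = m_W(t) − m_1(t) − E(bg_1)` with `m_V(t)` the first-order term of the `(A + tF_V)`-step at `V`;
  ★★ `hasDerivAt_stepOutT_pencilSlope_zero` — the slope function `t ↦ m_W(t) − m_1(t) − E(bg_1)` has derivative `Var_{μW}(F_W) − Var_{μ1}(F_1)` at `0`: THE PENCIL'S SECOND TAYLOR
  COEFFICIENT AT THE ZERO-INPUT END IS THE DIFFERENCE OF THE FIBRE VARIANCES of print's curly bracket at `W` and at `1`.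
HONEST FRAMING.  Calculus bookkeeping (dominated differentiation, quotient rule); fibre laws, positivity and bounds DISPLAYED; NOTHING of Bałaban's estimates asserted, ported or discharged;
no named fact introduced; 26648 ∕ 27930⁸ SIGNED·OPEN (content-gated), 27931 OPEN (RC-3), 27932 CLOSED; K0⁷ ∕ K-Ax OPEN; counts unmoved; finite 𝕋⁴ at fixed ε — NOT continuum ∕ OS ∕ Clay; the
Yang–Mills mass gap is NOT proved by any of this.  No `sorry`, no `instance`, no `notation`, no `def`.
-/

noncomputable section

open MeasureTheory

namespace Summit.QuantumFields.YangMills.Theorems.PortZD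

open Literature.MathematicalPhysics.QuantumFieldTheory.Balaban1983to89
open Literature.MathematicalPhysics.QuantumFieldTheory.Balaban1983to89.Node00
open Literature.MathematicalPhysics.QuantumFieldTheory.Balaban1983to89.Node00.ZeroInput
open T4Continuum (T4Family)
open B12Eq019ActionBody (nextAction normConst integrand integrand_apply)

/-! ## §1. The second derivative of `∫ e^{tF}` and the second cumulant -/

section Generic

variable {X : Type*} [MeasurableSpace X] {μ : Measure X} [IsProbabilityMeasure μ] {F : X → ℝ} {M : ℝ}

/-- ★ **`t ↦ ∫ F·e^{tF} dμ` HAS DERIVATIVE `∫ F²·e^{tF} dμ` AT EVERY `t`** (`|F| ≤ M` a.e.; dominated differentiation with bound `M²e^{(|t|+1)M}` on the unit ball).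
[cite: Balaban1988RG2Cluster, (1.9) p.4 (bookkeeping)] -/
theorem hasDerivAt_integral_mul_exp_mul_of_ae_bound (hFm : AEStronglyMeasurable F μ) (hb : ∀ᵐ x ∂μ, |F x| ≤ M) (t : ℝ) :
    HasDerivAt (fun s => ∫ x, F x * Real.exp (s * F x) ∂μ) (∫ x, F x ^ 2 * Real.exp (t * F x) ∂μ) t := by
  have hM : 0 ≤ M := by
    obtain ⟨x, hx⟩ := hb.exists
    exact (abs_nonneg _).trans hx
  have hint : Integrable (fun x => F x * Real.exp (t * F x)) μ := by
    refine Integrable.mono' (integrable_const (M * Real.exp (|t| * M))) (hFm.mul (Real.continuous_exp.comp_aestronglyMeasurable (hFm.const_mul t))) ?_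
    filter_upwards [hb] with x hx
    rw [Real.norm_eq_abs, abs_mul, abs_of_pos (Real.exp_pos _)]
    refine mul_le_mul hx (Real.exp_le_exp.2 ?_) (Real.exp_pos _).le hM
    calc t * F x ≤ |t * F x| := le_abs_self _
      _ = |t| * |F x| := abs_mul _ _
      _ ≤ |t| * M := mul_le_mul_of_nonneg_left hx (abs_nonneg _)
  have h := hasDerivAt_integral_of_dominated_loc_of_deriv_le (μ := μ) (F := fun s x => F x * Real.exp (s * F x))
    (F' := fun s x => F x ^ 2 * Real.exp (s * F x)) (x₀ := t) (bound := fun _ => M ^ 2 * Real.exp ((|t| + 1) * M)) (s := Metric.ball t 1)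
    (Metric.ball_mem_nhds t one_pos)
    (Filter.Eventually.of_forall fun s => hFm.mul (Real.continuous_exp.comp_aestronglyMeasurable (hFm.const_mul s)))
    hint
    ((hFm.pow 2).mul (Real.continuous_exp.comp_aestronglyMeasurable (hFm.const_mul t)))
    (by
      filter_upwards [hb] with x hx s hs
      rw [Metric.mem_ball, Real.dist_eq] at hs
      rw [Real.norm_eq_abs, abs_mul, abs_of_pos (Real.exp_pos _), abs_of_nonneg (sq_nonneg _)]
      have hs' : |s| ≤ |t| + 1 := by
        have h1 := abs_sub_abs_le_abs_sub s t
        linarith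
      have hF2 : F x ^ 2 ≤ M ^ 2 := by
        have := hx; rw [← sq_abs]; exact pow_le_pow_left₀ (abs_nonneg _) hx 2
      refine mul_le_mul hF2 (Real.exp_le_exp.2 ?_) (Real.exp_pos _).le (sq_nonneg _)
      calc s * F x ≤ |s * F x| := le_abs_self _
        _ = |s| * |F x| := abs_mul _ _
        _ ≤ (|t| + 1) * M := mul_le_mul hs' hx (abs_nonneg _) (by positivity))
    (integrable_const _)
    (Filter.Eventually.of_forall fun x s _ => by
      have h := ((Real.hasDerivAt_exp (s * F x)).comp s (hasDerivAt_mul_const (F x))).const_mul (F x)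
      have h' : HasDerivAt (fun s => F x * Real.exp (s * F x)) (F x * (Real.exp (s * F x) * F x)) s := h
      have he : F x * (Real.exp (s * F x) * F x) = F x ^ 2 * Real.exp (s * F x) := by ring
      rw [he] at h'
      exact h')
  exact h.2

/-- ★ **THE SECOND CUMULANT**: the tilted mean `t ↦ ∫ F e^{tF} ∕ ∫ e^{tF}` has derivative `∫ F² dμ − (∫ F dμ)²` at `t = 0`. [cite: Balaban1988RG2Cluster, p.21 (bookkeeping: second-order remainder)] -/
theorem hasDerivAt_tiltedMean_zero_of_ae_bound (hFm : AEStronglyMeasurable F μ) (hb : ∀ᵐ x ∂μ, |F x| ≤ M) :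
    HasDerivAt (fun s => (∫ x, F x * Real.exp (s * F x) ∂μ) / ∫ x, Real.exp (s * F x) ∂μ)
      ((∫ x, F x ^ 2 ∂μ) - (∫ x, F x ∂μ) ^ 2) 0 := by
  have hnum := hasDerivAt_integral_mul_exp_mul_of_ae_bound hFm hb 0
  have hden := hasDerivAt_integral_exp_mul_of_ae_bound hFm hb 0
  have h0 : ∫ x, Real.exp (0 * F x) ∂μ = 1 := by simp
  have h1 : ∫ x, F x * Real.exp (0 * F x) ∂μ = ∫ x, F x ∂μ := by simp
  have h2 : ∫ x, F x ^ 2 * Real.exp (0 * F x) ∂μ = ∫ x, F x ^ 2 ∂μ := by simp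
  rw [h1] at hden
  rw [h2] at hnum
  have h := hnum.div hden (by rw [h0]; exact one_ne_zero)
  rw [h0, h1] at h
  have he : ((∫ x, F x ^ 2 ∂μ) * 1 - (∫ x, F x ∂μ) * ∫ x, F x ∂μ) / 1 ^ 2 = (∫ x, F x ^ 2 ∂μ) - (∫ x, F x ∂μ) ^ 2 := by ring
  rw [he] at h
  exact h

end Generic

/-! ## §2. The interpolating first-order term's slope at `0` is the fibre variance -/

section StepLaw

variable {P : Params} {G : Type*} {k : ℕ} [MeasurableSpace (GaugeField P k G)]

/-- ★ Under the fibre law of the `A`-step at `V` (`T(I(A))(V) ≠ 0`, `|F| ≤ M` a.e.): `t ↦ T(F·I(A + tF))(V) ∕ T(I(A + tF))(V)` has derivative `∫F² dμ − (∫F dμ)²` at `0`.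
[cite: Balaban1987RG1, (2.12)–(2.14) p.268; Balaban1988RG2Cluster, p.21 (bookkeeping)] -/
theorem hasDerivAt_firstOrder_zero_of_stepLaw {T : Density P k G → Density P (k + 1) G} {χ GF : Density P k G} {gk : ℝ} {A : Density P k G}
    {V : GaugeField P (k + 1) G} {μ : Measure (GaugeField P k G)}
    (hμ : ∀ f : Density P k G, ∫ U, f U ∂μ = T (fun U => f U * integrand χ GF gk A U) V / T (integrand χ GF gk A) V)
    (hZ : T (integrand χ GF gk A) V ≠ 0) (F : Density P k G) {M : ℝ} (hFm : AEStronglyMeasurable F μ) (hb : ∀ᵐ U ∂μ, |F U| ≤ M) :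
    HasDerivAt (fun t : ℝ => T (fun U => F U * integrand χ GF gk (A + t • F) U) V / T (integrand χ GF gk (A + t • F)) V)
      ((∫ U, F U ^ 2 ∂μ) - (∫ U, F U ∂μ) ^ 2) 0 := by
  haveI := isProbabilityMeasure_of_stepLaw hμ hZ
  have hfun : (fun t : ℝ => T (fun U => F U * integrand χ GF gk (A + t • F) U) V / T (integrand χ GF gk (A + t • F)) V) =
      fun t => (∫ U, F U * Real.exp (t * F U) ∂μ) / ∫ U, Real.exp (t * F U) ∂μ := by
    funext t; exact (tiltedMean_eq_firstOrder_of_stepLaw hμ hZ F t).symm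
  rw [hfun]
  exact hasDerivAt_tiltedMean_zero_of_ae_bound hFm hb

end StepLaw

/-! ## §3. The pencil: derivative at every `t`, second Taylor coefficient at the zero end -/

variable (F : T4Family) (N : ℕ) [NeZero N]

/-- ★★ **THE GLOBAL PENCIL IDENTITY**: `T K k` degree-one homogeneous, fibre laws of the `A`-step at `W`, `1`, the `A`-step defined there, brackets a.e.-bounded ⟹ for EVERY `t`,
`R_k(A + tE)(W) = R_k(A)(W) + log[T(I(A + t·F_W))(W) ∕ T(I(A))(W)] − log[T(I(A + t·F_1))(1) ∕ T(I(A))(1)] − t·E(bg_1)`, `F_V := E − E(bg_V)`.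
[cite: Balaban1987RG1, (1.6) p.261, (2.12)–(2.14) p.268] -/
theorem stepOutT_pencil_eq (T : Transport F N) (χ : (K : ℕ) → (ℕ → ℝ) → (k : ℕ) → Density (F.P K) k (SU N)) (ε : ℝ) (K : ℕ)
    (g : ℕ → ℝ) (k : ℕ) (hT : ∀ (a : ℝ) (ρ : Density (F.P K) k (SU N)), T K k (fun U => a * ρ U) = fun V => a * T K k ρ V)
    (A E : Density (F.P K) k (SU N)) (W : GaugeField (F.P K) (k + 1) (SU N)) {μW μ1 : Measure (GaugeField (F.P K) k (SU N))}
    (hμW : ∀ f : Density (F.P K) k (SU N),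
      ∫ U, f U ∂μW = T K k (fun U => f U * integrand (χ K g k) (gfOfRecord F N K k) (g k) A U) W / T K k (integrand (χ K g k) (gfOfRecord F N K k) (g k) A) W)
    (hμ1 : ∀ f : Density (F.P K) k (SU N),
      ∫ U, f U ∂μ1 = T K k (fun U => f U * integrand (χ K g k) (gfOfRecord F N K k) (g k) A U) 1 / T K k (integrand (χ K g k) (gfOfRecord F N K k) (g k) A) 1)
    (hAW : 0 < T K k (integrand (χ K g k) (gfOfRecord F N K k) (g k) A) W)
    (hA1 : 0 < T K k (integrand (χ K g k) (gfOfRecord F N K k) (g k) A) 1) {MW M1 : ℝ}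
    (hmW : AEStronglyMeasurable (fun U => E U - E (Averaging.iter (avOfRecord F N K) k (Uk F N K (k + 1) ε W))) μW)
    (hm1 : AEStronglyMeasurable (fun U => E U - E (Averaging.iter (avOfRecord F N K) k (Uk F N K (k + 1) ε 1))) μ1)
    (hbW : ∀ᵐ U ∂μW, |E U - E (Averaging.iter (avOfRecord F N K) k (Uk F N K (k + 1) ε W))| ≤ MW)
    (hb1 : ∀ᵐ U ∂μ1, |E U - E (Averaging.iter (avOfRecord F N K) k (Uk F N K (k + 1) ε 1))| ≤ M1) (t : ℝ) :
    stepOutT F N T χ ε K g k (A + t • E) W = stepOutT F N T χ ε K g k A W +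
      (Real.log (T K k (integrand (χ K g k) (gfOfRecord F N K k) (g k)
          (A + t • fun U => E U - E (Averaging.iter (avOfRecord F N K) k (Uk F N K (k + 1) ε W)))) W /
          T K k (integrand (χ K g k) (gfOfRecord F N K k) (g k) A) W) -
        Real.log (T K k (integrand (χ K g k) (gfOfRecord F N K k) (g k)
          (A + t • fun U => E U - E (Averaging.iter (avOfRecord F N K) k (Uk F N K (k + 1) ε 1)))) 1 /
          T K k (integrand (χ K g k) (gfOfRecord F N K k) (g k) A) 1) -
        t * E (Averaging.iter (avOfRecord F N K) k (Uk F N K (k + 1) ε 1))) := by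
  set cW := E (Averaging.iter (avOfRecord F N K) k (Uk F N K (k + 1) ε W)) with hcW
  set c1 := E (Averaging.iter (avOfRecord F N K) k (Uk F N K (k + 1) ε 1)) with hc1
  haveI := isProbabilityMeasure_of_stepLaw hμW hAW.ne'
  haveI := isProbabilityMeasure_of_stepLaw hμ1 hA1.ne'
  have hsW : (fun U => (t • E) U - (t • E) (Averaging.iter (avOfRecord F N K) k (Uk F N K (k + 1) ε W))) = t • fun U => E U - cW := by
    funext U; simp only [Pi.smul_apply, smul_eq_mul, hcW]; ring
  have hs1 : (fun U => (t • E) U - (t • E) (Averaging.iter (avOfRecord F N K) k (Uk F N K (k + 1) ε 1))) = t • fun U => E U - c1 := by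
    funext U; simp only [Pi.smul_apply, smul_eq_mul, hc1]; ring
  have hXW : 0 < T K k (integrand (χ K g k) (gfOfRecord F N K k) (g k) (A + t • fun U => E U - cW)) W :=
    transport_integrand_add_pos_of_stepLaw hμW hAW _ (by
      simpa only [Pi.smul_apply, smul_eq_mul] using integrable_exp_mul_of_ae_bound hmW hbW t)
  have hX1 : 0 < T K k (integrand (χ K g k) (gfOfRecord F N K k) (g k) (A + t • fun U => E U - c1)) 1 :=
    transport_integrand_add_pos_of_stepLaw hμ1 hA1 _ (by
      simpa only [Pi.smul_apply, smul_eq_mul] using integrable_exp_mul_of_ae_bound hm1 hb1 t)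
  have hEW : 0 < T K k (integrand (χ K g k) (gfOfRecord F N K k) (g k) (A + t • E)) W := by
    rw [transport_integrand_add_recentre hT _ _ _ A (t • E) (t * cW) W]
    have : (A + fun U => (t • E) U - t * cW) = A + t • fun U => E U - cW := by
      funext U; simp only [Pi.add_apply, Pi.smul_apply, smul_eq_mul]; ring
    rw [this]; exact mul_pos (Real.exp_pos _) hXW
  have hE1 : 0 < T K k (integrand (χ K g k) (gfOfRecord F N K k) (g k) (A + t • E)) 1 := by
    rw [transport_integrand_add_recentre hT _ _ _ A (t • E) (t * c1) 1]
    have : (A + fun U => (t • E) U - t * c1) = A + t • fun U => E U - c1 := by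
      funext U; simp only [Pi.add_apply, Pi.smul_apply, smul_eq_mul]; ring
    rw [this]; exact mul_pos (Real.exp_pos _) hX1
  have h := stepOutT_add_sub_eq_log_fluct F N T χ ε K g k hT A (t • E) W hAW hA1 hEW hE1
  rw [hsW, hs1] at h
  have h' : (t • E) (Averaging.iter (avOfRecord F N K) k (Uk F N K (k + 1) ε 1)) = t * c1 := by
    simp only [Pi.smul_apply, smul_eq_mul, hc1]
  rw [h'] at h
  linarith

/-- ★★ **THE PENCIL'S DERIVATIVE AT EVERY `t`**: `d∕dt R_k(A + tE)(W) = m_W(t) − m_1(t) − E(bg_1)`, where `m_V(t) := T(F_V·I(A + tF_V))(V) ∕ T(I(A + tF_V))(V)` is the first-order term of the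
INTERPOLATING step (the tilted fibre mean of the bracket). [cite: Balaban1988RG2Cluster, (1.9) p.4; Balaban1987RG1, (2.12)–(2.14) p.268] -/
theorem hasDerivAt_stepOutT_pencil (T : Transport F N) (χ : (K : ℕ) → (ℕ → ℝ) → (k : ℕ) → Density (F.P K) k (SU N)) (ε : ℝ) (K : ℕ)
    (g : ℕ → ℝ) (k : ℕ) (hT : ∀ (a : ℝ) (ρ : Density (F.P K) k (SU N)), T K k (fun U => a * ρ U) = fun V => a * T K k ρ V)
    (A E : Density (F.P K) k (SU N)) (W : GaugeField (F.P K) (k + 1) (SU N)) {μW μ1 : Measure (GaugeField (F.P K) k (SU N))}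
    (hμW : ∀ f : Density (F.P K) k (SU N),
      ∫ U, f U ∂μW = T K k (fun U => f U * integrand (χ K g k) (gfOfRecord F N K k) (g k) A U) W / T K k (integrand (χ K g k) (gfOfRecord F N K k) (g k) A) W)
    (hμ1 : ∀ f : Density (F.P K) k (SU N),
      ∫ U, f U ∂μ1 = T K k (fun U => f U * integrand (χ K g k) (gfOfRecord F N K k) (g k) A U) 1 / T K k (integrand (χ K g k) (gfOfRecord F N K k) (g k) A) 1)
    (hAW : 0 < T K k (integrand (χ K g k) (gfOfRecord F N K k) (g k) A) W)
    (hA1 : 0 < T K k (integrand (χ K g k) (gfOfRecord F N K k) (g k) A) 1) {MW M1 : ℝ}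
    (hmW : AEStronglyMeasurable (fun U => E U - E (Averaging.iter (avOfRecord F N K) k (Uk F N K (k + 1) ε W))) μW)
    (hm1 : AEStronglyMeasurable (fun U => E U - E (Averaging.iter (avOfRecord F N K) k (Uk F N K (k + 1) ε 1))) μ1)
    (hbW : ∀ᵐ U ∂μW, |E U - E (Averaging.iter (avOfRecord F N K) k (Uk F N K (k + 1) ε W))| ≤ MW)
    (hb1 : ∀ᵐ U ∂μ1, |E U - E (Averaging.iter (avOfRecord F N K) k (Uk F N K (k + 1) ε 1))| ≤ M1) (t : ℝ) :
    HasDerivAt (fun s : ℝ => stepOutT F N T χ ε K g k (A + s • E) W)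
      (T K k (fun U => (E U - E (Averaging.iter (avOfRecord F N K) k (Uk F N K (k + 1) ε W))) *
            integrand (χ K g k) (gfOfRecord F N K k) (g k) (A + t • fun U => E U - E (Averaging.iter (avOfRecord F N K) k (Uk F N K (k + 1) ε W))) U) W /
          T K k (integrand (χ K g k) (gfOfRecord F N K k) (g k) (A + t • fun U => E U - E (Averaging.iter (avOfRecord F N K) k (Uk F N K (k + 1) ε W)))) W -
        T K k (fun U => (E U - E (Averaging.iter (avOfRecord F N K) k (Uk F N K (k + 1) ε 1))) *
            integrand (χ K g k) (gfOfRecord F N K k) (g k) (A + t • fun U => E U - E (Averaging.iter (avOfRecord F N K) k (Uk F N K (k + 1) ε 1))) U) 1 /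
          T K k (integrand (χ K g k) (gfOfRecord F N K k) (g k) (A + t • fun U => E U - E (Averaging.iter (avOfRecord F N K) k (Uk F N K (k + 1) ε 1)))) 1 -
        E (Averaging.iter (avOfRecord F N K) k (Uk F N K (k + 1) ε 1))) t := by
  set cW := E (Averaging.iter (avOfRecord F N K) k (Uk F N K (k + 1) ε W)) with hcW
  set c1 := E (Averaging.iter (avOfRecord F N K) k (Uk F N K (k + 1) ε 1)) with hc1
  haveI := isProbabilityMeasure_of_stepLaw hμW hAW.ne'
  haveI := isProbabilityMeasure_of_stepLaw hμ1 hA1.ne'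
  have hfun : (fun s : ℝ => stepOutT F N T χ ε K g k (A + s • E) W) = fun s => stepOutT F N T χ ε K g k A W +
      (Real.log (∫ U, Real.exp (s * (E U - cW)) ∂μW) - Real.log (∫ U, Real.exp (s * (E U - c1)) ∂μ1) - s * c1) := by
    funext s
    rw [stepOutT_pencil_eq F N T χ ε K g k hT A E W hμW hμ1 hAW hA1 hmW hm1 hbW hb1 s,
      moment_eq_integral_exp_of_stepLaw hμW (s • fun U => E U - cW), moment_eq_integral_exp_of_stepLaw hμ1 (s • fun U => E U - c1)]
    simp only [Pi.smul_apply, smul_eq_mul]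
    rw [← hc1]
  rw [hfun]
  have hDW := hasDerivAt_log_integral_exp_mul_of_ae_bound hmW hbW t
  have hD1 := hasDerivAt_log_integral_exp_mul_of_ae_bound hm1 hb1 t
  have hlin : HasDerivAt (fun s : ℝ => s * c1) c1 t := by simpa using hasDerivAt_mul_const (x := t) c1
  have h := ((hDW.sub hD1).sub hlin).const_add (stepOutT F N T χ ε K g k A W)
  rw [tiltedMean_eq_firstOrder_of_stepLaw hμW hAW.ne' (fun U => E U - cW) t, tiltedMean_eq_firstOrder_of_stepLaw hμ1 hA1.ne' (fun U => E U - c1) t] at h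
  exact h

/-- ★★ **THE PENCIL'S SECOND TAYLOR COEFFICIENT AT THE ZERO-INPUT END IS THE DIFFERENCE OF THE FIBRE VARIANCES**: the slope function
`t ↦ m_W(t) − m_1(t) − E(bg_1)` has derivative `Var_{μW}(F_W) − Var_{μ1}(F_1)` at `t = 0`. [cite: Balaban1988RG2Cluster, p.21 (second-order remainder); Balaban1987RG1, (2.12)–(2.14) p.268] -/
theorem hasDerivAt_stepOutT_pencilSlope_zero (T : Transport F N) (χ : (K : ℕ) → (ℕ → ℝ) → (k : ℕ) → Density (F.P K) k (SU N)) (ε : ℝ) (K : ℕ)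
    (g : ℕ → ℝ) (k : ℕ) (A E : Density (F.P K) k (SU N)) (W : GaugeField (F.P K) (k + 1) (SU N)) {μW μ1 : Measure (GaugeField (F.P K) k (SU N))}
    (hμW : ∀ f : Density (F.P K) k (SU N),
      ∫ U, f U ∂μW = T K k (fun U => f U * integrand (χ K g k) (gfOfRecord F N K k) (g k) A U) W / T K k (integrand (χ K g k) (gfOfRecord F N K k) (g k) A) W)
    (hμ1 : ∀ f : Density (F.P K) k (SU N),
      ∫ U, f U ∂μ1 = T K k (fun U => f U * integrand (χ K g k) (gfOfRecord F N K k) (g k) A U) 1 / T K k (integrand (χ K g k) (gfOfRecord F N K k) (g k) A) 1)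
    (hAW : T K k (integrand (χ K g k) (gfOfRecord F N K k) (g k) A) W ≠ 0)
    (hA1 : T K k (integrand (χ K g k) (gfOfRecord F N K k) (g k) A) 1 ≠ 0) {MW M1 : ℝ}
    (hmW : AEStronglyMeasurable (fun U => E U - E (Averaging.iter (avOfRecord F N K) k (Uk F N K (k + 1) ε W))) μW)
    (hm1 : AEStronglyMeasurable (fun U => E U - E (Averaging.iter (avOfRecord F N K) k (Uk F N K (k + 1) ε 1))) μ1)
    (hbW : ∀ᵐ U ∂μW, |E U - E (Averaging.iter (avOfRecord F N K) k (Uk F N K (k + 1) ε W))| ≤ MW)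
    (hb1 : ∀ᵐ U ∂μ1, |E U - E (Averaging.iter (avOfRecord F N K) k (Uk F N K (k + 1) ε 1))| ≤ M1) :
    HasDerivAt (fun t : ℝ =>
      T K k (fun U => (E U - E (Averaging.iter (avOfRecord F N K) k (Uk F N K (k + 1) ε W))) *
            integrand (χ K g k) (gfOfRecord F N K k) (g k) (A + t • fun U => E U - E (Averaging.iter (avOfRecord F N K) k (Uk F N K (k + 1) ε W))) U) W /
          T K k (integrand (χ K g k) (gfOfRecord F N K k) (g k) (A + t • fun U => E U - E (Averaging.iter (avOfRecord F N K) k (Uk F N K (k + 1) ε W)))) W -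
        T K k (fun U => (E U - E (Averaging.iter (avOfRecord F N K) k (Uk F N K (k + 1) ε 1))) *
            integrand (χ K g k) (gfOfRecord F N K k) (g k) (A + t • fun U => E U - E (Averaging.iter (avOfRecord F N K) k (Uk F N K (k + 1) ε 1))) U) 1 /
          T K k (integrand (χ K g k) (gfOfRecord F N K k) (g k) (A + t • fun U => E U - E (Averaging.iter (avOfRecord F N K) k (Uk F N K (k + 1) ε 1)))) 1 -
        E (Averaging.iter (avOfRecord F N K) k (Uk F N K (k + 1) ε 1)))
      (((∫ U, (E U - E (Averaging.iter (avOfRecord F N K) k (Uk F N K (k + 1) ε W))) ^ 2 ∂μW) -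
          (∫ U, (E U - E (Averaging.iter (avOfRecord F N K) k (Uk F N K (k + 1) ε W))) ∂μW) ^ 2) -
        ((∫ U, (E U - E (Averaging.iter (avOfRecord F N K) k (Uk F N K (k + 1) ε 1))) ^ 2 ∂μ1) -
          (∫ U, (E U - E (Averaging.iter (avOfRecord F N K) k (Uk F N K (k + 1) ε 1))) ∂μ1) ^ 2)) 0 := by
  have hDW := hasDerivAt_firstOrder_zero_of_stepLaw hμW hAW (fun U => E U - E (Averaging.iter (avOfRecord F N K) k (Uk F N K (k + 1) ε W))) hmW hbW
  have hD1 := hasDerivAt_firstOrder_zero_of_stepLaw hμ1 hA1 (fun U => E U - E (Averaging.iter (avOfRecord F N K) k (Uk F N K (k + 1) ε 1))) hm1 hb1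
  have h := (hDW.sub hD1).sub_const (E (Averaging.iter (avOfRecord F N K) k (Uk F N K (k + 1) ε 1)))
  exact h

end Summit.QuantumFields.YangMills.Theorems.PortZD

end
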